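import Summits.HodgeConjecture.HodgeConjecture.Theses.SevenfoldWeilCensus

/-!
# Birth skeleton — `CodimThreeWeilGeneration` (route `SevenfoldWeilCensus`, crux X1, item stmt-HodgeConjecture-18720)

BC3 skeleton of the codimension-3 census crux X1: on a complex abelian variety `A` of dimension 6 or 7
every rational `(3,3)`-class lies in `D³ ⊔ B²·B¹ ⊔ (pull-backs of rational (3,3)-classes from abelian
varieties of smaller dimension) ⊔ (pull-backs of Weil classes of abelian sixfolds of Weil type)`.

The line is the Moonen–Zarhin census shape (arXiv:math/9901113, §§3–4 and Thm. on p. 6), one and two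
dimensions up, cut along the two case distinctions that organise EVERY known census of Hodge classes on
abelian varieties — simple / non-simple (Poincaré reducibility) and, for simple ones, the dimension:

* `stub_simple_prime_seven` — TANKEEV–RIBET SECTOR. A simple abelian variety of PRIME dimension has
  Hodge group `Sp_D(V, φ)` and `B•(Xⁿ) = D•(Xⁿ)` (Tankeev 1982, Ribet 1983; van Geemen LNM 1594 Thm. 4.6,
  p. 218; Moonen–Zarhin 1999 Thm. (2.?) p. 6: "Let X be a simple complex abelian variety such that dim X
  is a prime number. Then Hg(X) = Sp_D(V, φ) and B(Xⁿ) = D(Xⁿ)"). `7` is prime, so on a SIMPLE sevenfold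
  every rational `(3,3)`-class is a polynomial in divisor classes: the sharper conclusion
  `c ∈ divisorClassesSpan A.X A.dim 3` (no Weil / pull-back generators needed). A theorem in print, not
  in the tree (no `Literature` fact names it yet): size L as a formalisation (Mumford–Tate groups of type
  I(e | 7) and IV(CM field of degree 2 or 14) sevenfolds + invariant theory of `Sp`/`U`), or M as a bridge
  from a claim-tagged Literature fact once vendored.
* `stub_simple_six` — THE OPEN HEART. Simple abelian SIXFOLDS by Albert type: I (e = 1, 2, 3, 6),
  II/III (e = 1, 3), IV (imaginary quadratic K with multiplicities (3,3) = Weil type, (2,4), (1,5); CM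
  field of degree 4, 6 or 12, incl. Dodson's degenerate CM types with non-abelian Galois closure). Claim:
  the only codimension-3 exceptional classes are Weil classes `W_K = ⋀⁶_K H¹` of the sixfold itself for
  its imaginary quadratic multiplications of signature (3,3) (4th generator family with `B = A`, `g = 𝟙`),
  everything else is in `D³ ⊔ B²·B¹`. This is the Moonen–Zarhin 1995/1999 simple-fourfold analysis two
  ranks up (length-one / minuscule-weight constraints on `hg ⊗ ℂ` acting on `V_ℂ`, `dim V = 12`); it may
  FAIL exactly where the crux may fail (type III sixfolds, `B³ ≠ D³` by Murty–Hazama, van Geemen 4.13;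
  small Mumford–Tate groups with `End = ℤ`, e.g. ℚ-forms of `SO₃ × Sp₄` on `3 ⊗ 4`).
* `stub_nonsimple` — PRODUCT SECTOR. Non-simple 6- or 7-folds `A ~ A₁ × A₂`: Hodge classes in the Künneth
  components `H^{2a}(A₁) ⊗ H^{2b}(A₂)` and `H^{odd} ⊗ H^{odd}`, controlled by `Hg(A₁ × A₂) ⊆ Hg(A₁) × Hg(A₂)`
  (Moonen–Zarhin 1999 §3 "The Hodge group of a product", Hazama, Duke Math. J. 58 (1989) "Algebraic cycles
  on nonsimple abelian varieties"), with every factor of dimension ≤ 5 completely censused by MZ99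
  Thms. 0.1–0.2. Claim: all codimension-3 Hodge classes of the product are divisor monomials, products
  (2,2)·(1,1), pull-backs from factors / lower-dimensional quotients, or pull-backs of sixfold Weil
  classes. May fail on `E × (fivefold)` / `(threefold)²`-type products with extra `hg`-invariants in
  `H¹ ⊗ H⁵` or `H³ ⊗ H³` (Shioda-type exceptional classes) that are not pulled back from a quotient.

Composition: `CodimThreeWeilGeneration_of_stubs : <stub₁-sig> → <stub₂-sig> → <stub₃-sig> → <body of the crux>`
is a REAL proof (case split on `AbelianVariety.IsSimple A` (classical) and on `A.dim = 6 ∨ A.dim = 7`; the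
prime-dimension stub feeds the first summand of the target span, `Submodule.mem_sup_left` ×3), and
`CodimThreeWeilGeneration_of : CodimThreeWeilGeneration := CodimThreeWeilGeneration_of_stubs stub₁ stub₂ stub₃`
concludes the crux BY NAME with no hypotheses; `sorry` occurs ONLY in the three `stub_*` theorems. No stub is
the crux (each covers a proper sub-case: simple ∧ 7, simple ∧ 6, non-simple) and none mentions algebraicity,
so none gives the summit (BC3 probes in the planner folder `bc/probe_*`: stub → crux and stub → summit FAIL 6/6).

Honours: no `Disproof.lean` exists for this crux yet (`ledger crux ls`: no workfiles); negatives index of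
the summit (MilnorK symbol lift, Fermat K3 exhaustion, E-line transport) is disjoint from these statements.
-/

-- `Summit.<Summit>.<Problem>`: for the single-conjunct summit `HodgeConjecture` the duplicate namespace is mandated.
set_option linter.dupNamespace false

namespace Summit.HodgeConjecture.HodgeConjecture.Cruxes.CodimThreeWeilGeneration.Birth

open Summit.HodgeConjecture.HodgeConjecture.Theses.SevenfoldWeilCensus (CodimThreeWeilGeneration)

/-- **Stub 1 — Tankeev–Ribet sector (simple sevenfolds; 7 is prime).** On a SIMPLE complex abelian
variety of dimension `7` every rational `(3,3)`-class is a `ℂ`-combination of divisor monomials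
(`B³ = D³`: Tankeev1983, Ribet1983; van Geemen LNM 1594 Thm. 4.6; Moonen–Zarhin 1999 p. 6). In print,
not in the tree. [cite: Tankeev1983, Thm.] [cite: Ribet1983, Thm.] [cite: vanGeemen1994HodgeAV, Thm. 4.6]
[cite: MoonenZarhin1999LowDim, §2 (Tankeev–Ribet)] -/
theorem stub_simple_prime_seven : ∀ A : Literature.AlgebraicGeometry.Motives.AbelianVariety ℂ, A.dim = 7 → Literature.AlgebraicGeometry.Motives.AbelianVariety.IsSimple A → ∀ c : Literature.AlgebraicGeometry.HodgeTheory.complexBetti A.X (2 * 3), Literature.AlgebraicGeometry.HodgeTheory.IsRationalClass c → Literature.AlgebraicGeometry.HodgeTheory.IsOfHodgeType A.dim A.X (2 * 3) 3 3 c → c ∈ Literature.Barriers.HodgeConjecture.divisorClassesSpan A.X A.dim 3 := by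
  sorry

/-- **Stub 2 — the simple-sixfold census (open heart of X1).** On a SIMPLE complex abelian sixfold every
rational `(3,3)`-class lies in `D³ ⊔ B²·B¹ ⊔ (lower-dimensional pull-backs) ⊔ (pull-backs of Weil classes
of Weil-type sixfolds)` — by the Mumford–Tate classification the only new irreducible source predicted is
`W_K ⊂ B³` of the sixfold itself for `K` imaginary quadratic of signature `(3,3)`.
[cite: MoonenZarhin1999LowDim, §4 and Thm. 0.1 (the dim-4 model)] [cite: vanGeemen1994HodgeAV, 4.9–4.13] -/
theorem stub_simple_six : ∀ A : Literature.AlgebraicGeometry.Motives.AbelianVariety ℂ, A.dim = 6 → Literature.AlgebraicGeometry.Motives.AbelianVariety.IsSimple A → ∀ c : Literature.AlgebraicGeometry.HodgeTheory.complexBetti A.X (2 * 3), Literature.AlgebraicGeometry.HodgeTheory.IsRationalClass c → Literature.AlgebraicGeometry.HodgeTheory.IsOfHodgeType A.dim A.X (2 * 3) 3 3 c → c ∈ Literature.Barriers.HodgeConjecture.divisorClassesSpan A.X A.dim 3 ⊔ Submodule.span ℂ {w' : Literature.AlgebraicGeometry.HodgeTheory.complexBetti A.X (2 * 3) | ∃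 (a : Literature.AlgebraicGeometry.HodgeTheory.complexBetti A.X (2 * 2)) (b : Literature.AlgebraicGeometry.HodgeTheory.complexBetti A.X (2 * 1)), Literature.AlgebraicGeometry.HodgeTheory.IsRationalClass a ∧ Literature.AlgebraicGeometry.HodgeTheory.IsOfHodgeType A.dim A.X (2 * 2) 2 2 a ∧ Literature.AlgebraicGeometry.HodgeTheory.IsRationalClass b ∧ Literature.AlgebraicGeometry.HodgeTheory.IsOfHodgeType A.dim A.X (2 * 1) 1 1 b ∧ w' = Literature.AlgebraicTopology.SingularHomology.cupProduct (Literature.AlgebraicGeometry.HodgeTheory.two_mul_add_two_mul 2 1) a b} ⊔ Submodule.span ℂ {w' : Literature.AlgebraicGeometry.HodgeTheory.complexBetti A.X (2 * 3) | ∃ (C : Literature.AlgebraicGeometry.Motives.AbelianVariety ℂ) (g : A.X ⟶ C.X) (w : Literature.AlgebraicGeometry.HodgeTheory.complexBetti C.X (2 * 3)), C.dim < A.dim ∧ Literature.AlgebraicGeometry.HodgeTheory.IsRationalClass w ∧ Literature.AlgebraicGeometry.HodgeTheory.IsOfHodgeType C.dim C.X (2 * 3) 3 3 w ∧ w' = Literature.AlgebraicGeometry.HodgeTheory.complexBetti.map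 g (2 * 3) w} ⊔ Submodule.span ℂ {w' : Literature.AlgebraicGeometry.HodgeTheory.complexBetti A.X (2 * 3) | ∃ (B : Literature.AlgebraicGeometry.Motives.AbelianVariety ℂ) (g : A.X ⟶ B.X) (d : ℕ) (ψ : B ⟶ B) (w : Literature.AlgebraicGeometry.HodgeTheory.complexBetti B.X (2 * 3)), B.dim = 6 ∧ 0 < d ∧ CategoryTheory.CategoryStruct.comp ψ ψ = -(d • CategoryTheory.CategoryStruct.id B) ∧ Literature.AlgebraicGeometry.HodgeTheory.IsRationalClass w ∧ Literature.AlgebraicGeometry.HodgeTheory.IsOfHodgeType B.dim B.X (2 * 3) 3 3 w ∧ w ∈ Literature.AlgebraicGeometry.HodgeTheory.weilClassesOf B ψ 3 d ∧ w' = Literature.AlgebraicGeometry.HodgeTheory.complexBetti.map g (2 * 3) w} := by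
  sorry

/-- **Stub 3 — the product sector (non-simple 6- or 7-folds).** On a NON-SIMPLE complex abelian variety of
dimension 6 or 7 (isogenous to `A₁ × A₂`, `0 < dim Aᵢ`), every rational `(3,3)`-class lies in the four
spans: Künneth + `Hg(A₁ × A₂) ⊆ Hg(A₁) × Hg(A₂)` with surjective projections (Moonen–Zarhin 1999 §3;
Hazama 1989) and the complete census of the factors (dimension ≤ 5: MZ99 Thms. 0.1–0.2).
[cite: MoonenZarhin1999LowDim, §3] [cite: Hazama1989, Thm.] -/
theorem stub_nonsimple : ∀ A : Literature.AlgebraicGeometry.Motives.AbelianVariety ℂ, A.dim = 6 ∨ A.dim = 7 → ¬ Literature.AlgebraicGeometry.Motives.AbelianVariety.IsSimple A → ∀ c : Literature.AlgebraicGeometry.HodgeTheory.complexBetti A.X (2 * 3), Literature.AlgebraicGeometry.HodgeTheory.IsRationalClass c → Literature.AlgebraicGeometry.HodgeTheory.IsOfHodgeType A.dim A.X (2 * 3) 3 3 c → c ∈ Literature.Barriers.HodgeConjecture.divisorClassesSpan A.X A.dim 3 ⊔ Submodule.span ℂ {w' : Literature.AlgebraicGeometry.HodgeTheory.complexBetti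 A.X (2 * 3) | ∃ (a : Literature.AlgebraicGeometry.HodgeTheory.complexBetti A.X (2 * 2)) (b : Literature.AlgebraicGeometry.HodgeTheory.complexBetti A.X (2 * 1)), Literature.AlgebraicGeometry.HodgeTheory.IsRationalClass a ∧ Literature.AlgebraicGeometry.HodgeTheory.IsOfHodgeType A.dim A.X (2 * 2) 2 2 a ∧ Literature.AlgebraicGeometry.HodgeTheory.IsRationalClass b ∧ Literature.AlgebraicGeometry.HodgeTheory.IsOfHodgeType A.dim A.X (2 * 1) 1 1 b ∧ w' = Literature.AlgebraicTopology.SingularHomology.cupProduct (Literature.AlgebraicGeometry.HodgeTheory.two_mul_add_two_mul 2 1) a b} ⊔ Submodule.span ℂ {w' : Literature.AlgebraicGeometry.HodgeTheory.complexBetti A.X (2 * 3) | ∃ (C : Literature.AlgebraicGeometry.Motives.AbelianVariety ℂ) (g : A.X ⟶ C.X) (w : Literature.AlgebraicGeometry.HodgeTheory.complexBetti C.X (2 * 3)), C.dim < A.dim ∧ Literature.AlgebraicGeometry.HodgeTheory.IsRationalClass w ∧ Literature.AlgebraicGeometry.HodgeTheory.IsOfHodgeType C.dim C.X (2 * 3)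 3 3 w ∧ w' = Literature.AlgebraicGeometry.HodgeTheory.complexBetti.map g (2 * 3) w} ⊔ Submodule.span ℂ {w' : Literature.AlgebraicGeometry.HodgeTheory.complexBetti A.X (2 * 3) | ∃ (B : Literature.AlgebraicGeometry.Motives.AbelianVariety ℂ) (g : A.X ⟶ B.X) (d : ℕ) (ψ : B ⟶ B) (w : Literature.AlgebraicGeometry.HodgeTheory.complexBetti B.X (2 * 3)), B.dim = 6 ∧ 0 < d ∧ CategoryTheory.CategoryStruct.comp ψ ψ = -(d • CategoryTheory.CategoryStruct.id B) ∧ Literature.AlgebraicGeometry.HodgeTheory.IsRationalClass w ∧ Literature.AlgebraicGeometry.HodgeTheory.IsOfHodgeType B.dim B.X (2 * 3) 3 3 w ∧ w ∈ Literature.AlgebraicGeometry.HodgeTheory.weilClassesOf B ψ 3 d ∧ w' = Literature.AlgebraicGeometry.HodgeTheory.complexBetti.map g (2 * 3) w} := by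
  sorry

/-! ## Assembly (sorry-free) -/

/-- **Composition lemma (kernel-checked, no `sorry`).** The three sector statements imply the crux statement
(verbatim the body of `Summit.HodgeConjecture.HodgeConjecture.Theses.SevenfoldWeilCensus.CodimThreeWeilGeneration`):
the sectors exhaust abelian 6- or 7-folds (simple ∧ dim 7, simple ∧ dim 6, non-simple), and `D³` is the first
summand of the target span. [folklore] -/
theorem CodimThreeWeilGeneration_of_stubs
    (h7 : ∀ A : Literature.AlgebraicGeometry.Motives.AbelianVariety ℂ, A.dim = 7 → Literature.AlgebraicGeometry.Motives.AbelianVariety.IsSimple A → ∀ c : Literature.AlgebraicGeometry.HodgeTheory.complexBetti A.X (2 * 3), Literature.AlgebraicGeometry.HodgeTheory.IsRationalClass c → Literature.AlgebraicGeometry.HodgeTheory.IsOfHodgeType A.dim A.X (2 * 3) 3 3 c → c ∈ Literature.Barriers.HodgeConjecture.divisorClassesSpan A.X A.dim 3)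
    (h6 : ∀ A : Literature.AlgebraicGeometry.Motives.AbelianVariety ℂ, A.dim = 6 → Literature.AlgebraicGeometry.Motives.AbelianVariety.IsSimple A → ∀ c : Literature.AlgebraicGeometry.HodgeTheory.complexBetti A.X (2 * 3), Literature.AlgebraicGeometry.HodgeTheory.IsRationalClass c → Literature.AlgebraicGeometry.HodgeTheory.IsOfHodgeType A.dim A.X (2 * 3) 3 3 c → c ∈ Literature.Barriers.HodgeConjecture.divisorClassesSpan A.X A.dim 3 ⊔ Submodule.span ℂ {w' : Literature.AlgebraicGeometry.HodgeTheory.complexBetti A.X (2 * 3) | ∃ (a : Literature.AlgebraicGeometry.HodgeTheory.complexBetti A.X (2 * 2)) (b : Literature.AlgebraicGeometry.HodgeTheory.complexBetti A.X (2 * 1)), Literature.AlgebraicGeometry.HodgeTheory.IsRationalClass a ∧ Literature.AlgebraicGeometry.HodgeTheory.IsOfHodgeType A.dim A.X (2 * 2) 2 2 a ∧ Literature.AlgebraicGeometry.HodgeTheory.IsRationalClass b ∧ Literature.AlgebraicGeometry.HodgeTheory.IsOfHodgeType A.dim A.X (2 * 1) 1 1 b ∧ w' = Literature.AlgebraicTopology.SingularHomology.cupProduct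 (Literature.AlgebraicGeometry.HodgeTheory.two_mul_add_two_mul 2 1) a b} ⊔ Submodule.span ℂ {w' : Literature.AlgebraicGeometry.HodgeTheory.complexBetti A.X (2 * 3) | ∃ (C : Literature.AlgebraicGeometry.Motives.AbelianVariety ℂ) (g : A.X ⟶ C.X) (w : Literature.AlgebraicGeometry.HodgeTheory.complexBetti C.X (2 * 3)), C.dim < A.dim ∧ Literature.AlgebraicGeometry.HodgeTheory.IsRationalClass w ∧ Literature.AlgebraicGeometry.HodgeTheory.IsOfHodgeType C.dim C.X (2 * 3) 3 3 w ∧ w' = Literature.AlgebraicGeometry.HodgeTheory.complexBetti.map g (2 * 3) w} ⊔ Submodule.span ℂ {w' : Literature.AlgebraicGeometry.HodgeTheory.complexBetti A.X (2 * 3) | ∃ (B : Literature.AlgebraicGeometry.Motives.AbelianVariety ℂ) (g : A.X ⟶ B.X) (d : ℕ) (ψ : B ⟶ B) (w : Literature.AlgebraicGeometry.HodgeTheory.complexBetti B.X (2 * 3)), B.dim = 6 ∧ 0 < d ∧ CategoryTheory.CategoryStruct.comp ψ ψ = -(d • CategoryTheory.CategoryStruct.id B) ∧ Literature.AlgebraicGeometry.HodgeTheory.IsRationalClass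 w ∧ Literature.AlgebraicGeometry.HodgeTheory.IsOfHodgeType B.dim B.X (2 * 3) 3 3 w ∧ w ∈ Literature.AlgebraicGeometry.HodgeTheory.weilClassesOf B ψ 3 d ∧ w' = Literature.AlgebraicGeometry.HodgeTheory.complexBetti.map g (2 * 3) w})
    (hns : ∀ A : Literature.AlgebraicGeometry.Motives.AbelianVariety ℂ, A.dim = 6 ∨ A.dim = 7 → ¬ Literature.AlgebraicGeometry.Motives.AbelianVariety.IsSimple A → ∀ c : Literature.AlgebraicGeometry.HodgeTheory.complexBetti A.X (2 * 3), Literature.AlgebraicGeometry.HodgeTheory.IsRationalClass c → Literature.AlgebraicGeometry.HodgeTheory.IsOfHodgeType A.dim A.X (2 * 3) 3 3 c → c ∈ Literature.Barriers.HodgeConjecture.divisorClassesSpan A.X A.dim 3 ⊔ Submodule.span ℂ {w' : Literature.AlgebraicGeometry.HodgeTheory.complexBetti A.X (2 * 3) | ∃ (a : Literature.AlgebraicGeometry.HodgeTheory.complexBetti A.X (2 * 2)) (b : Literature.AlgebraicGeometry.HodgeTheory.complexBetti A.X (2 * 1)), Literature.AlgebraicGeometry.HodgeTheory.IsRationalClass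 a ∧ Literature.AlgebraicGeometry.HodgeTheory.IsOfHodgeType A.dim A.X (2 * 2) 2 2 a ∧ Literature.AlgebraicGeometry.HodgeTheory.IsRationalClass b ∧ Literature.AlgebraicGeometry.HodgeTheory.IsOfHodgeType A.dim A.X (2 * 1) 1 1 b ∧ w' = Literature.AlgebraicTopology.SingularHomology.cupProduct (Literature.AlgebraicGeometry.HodgeTheory.two_mul_add_two_mul 2 1) a b} ⊔ Submodule.span ℂ {w' : Literature.AlgebraicGeometry.HodgeTheory.complexBetti A.X (2 * 3) | ∃ (C : Literature.AlgebraicGeometry.Motives.AbelianVariety ℂ) (g : A.X ⟶ C.X) (w : Literature.AlgebraicGeometry.HodgeTheory.complexBetti C.X (2 * 3)), C.dim < A.dim ∧ Literature.AlgebraicGeometry.HodgeTheory.IsRationalClass w ∧ Literature.AlgebraicGeometry.HodgeTheory.IsOfHodgeType C.dim C.X (2 * 3) 3 3 w ∧ w' = Literature.AlgebraicGeometry.HodgeTheory.complexBetti.map g (2 * 3) w} ⊔ Submodule.span ℂ {w' : Literature.AlgebraicGeometry.HodgeTheory.complexBetti A.X (2 * 3) | ∃ (B : Literature.AlgebraicGeometry.Motives.AbelianVariety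 ℂ) (g : A.X ⟶ B.X) (d : ℕ) (ψ : B ⟶ B) (w : Literature.AlgebraicGeometry.HodgeTheory.complexBetti B.X (2 * 3)), B.dim = 6 ∧ 0 < d ∧ CategoryTheory.CategoryStruct.comp ψ ψ = -(d • CategoryTheory.CategoryStruct.id B) ∧ Literature.AlgebraicGeometry.HodgeTheory.IsRationalClass w ∧ Literature.AlgebraicGeometry.HodgeTheory.IsOfHodgeType B.dim B.X (2 * 3) 3 3 w ∧ w ∈ Literature.AlgebraicGeometry.HodgeTheory.weilClassesOf B ψ 3 d ∧ w' = Literature.AlgebraicGeometry.HodgeTheory.complexBetti.map g (2 * 3) w}) :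
    ∀ A : Literature.AlgebraicGeometry.Motives.AbelianVariety ℂ, A.dim = 6 ∨ A.dim = 7 → ∀ c : Literature.AlgebraicGeometry.HodgeTheory.complexBetti A.X (2 * 3), Literature.AlgebraicGeometry.HodgeTheory.IsRationalClass c → Literature.AlgebraicGeometry.HodgeTheory.IsOfHodgeType A.dim A.X (2 * 3) 3 3 c → c ∈ Literature.Barriers.HodgeConjecture.divisorClassesSpan A.X A.dim 3 ⊔ Submodule.span ℂ {w' : Literature.AlgebraicGeometry.HodgeTheory.complexBetti A.X (2 * 3) | ∃ (a : Literature.AlgebraicGeometry.HodgeTheory.complexBetti A.X (2 * 2)) (b : Literature.AlgebraicGeometry.HodgeTheory.complexBetti A.X (2 * 1)), Literature.AlgebraicGeometry.HodgeTheory.IsRationalClass a ∧ Literature.AlgebraicGeometry.HodgeTheory.IsOfHodgeType A.dim A.X (2 * 2) 2 2 a ∧ Literature.AlgebraicGeometry.HodgeTheory.IsRationalClass b ∧ Literature.AlgebraicGeometry.HodgeTheory.IsOfHodgeType A.dim A.X (2 * 1) 1 1 b ∧ w' = Literature.AlgebraicTopology.SingularHomology.cupProduct (Literature.AlgebraicGeometry.HodgeTheory.two_mul_add_two_mul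 2 1) a b} ⊔ Submodule.span ℂ {w' : Literature.AlgebraicGeometry.HodgeTheory.complexBetti A.X (2 * 3) | ∃ (C : Literature.AlgebraicGeometry.Motives.AbelianVariety ℂ) (g : A.X ⟶ C.X) (w : Literature.AlgebraicGeometry.HodgeTheory.complexBetti C.X (2 * 3)), C.dim < A.dim ∧ Literature.AlgebraicGeometry.HodgeTheory.IsRationalClass w ∧ Literature.AlgebraicGeometry.HodgeTheory.IsOfHodgeType C.dim C.X (2 * 3) 3 3 w ∧ w' = Literature.AlgebraicGeometry.HodgeTheory.complexBetti.map g (2 * 3) w} ⊔ Submodule.span ℂ {w' : Literature.AlgebraicGeometry.HodgeTheory.complexBetti A.X (2 * 3) | ∃ (B : Literature.AlgebraicGeometry.Motives.AbelianVariety ℂ) (g : A.X ⟶ B.X) (d : ℕ) (ψ : B ⟶ B) (w : Literature.AlgebraicGeometry.HodgeTheory.complexBetti B.X (2 * 3)), B.dim = 6 ∧ 0 < d ∧ CategoryTheory.CategoryStruct.comp ψ ψ = -(d • CategoryTheory.CategoryStruct.id B) ∧ Literature.AlgebraicGeometry.HodgeTheory.IsRationalClass w ∧ Literature.AlgebraicGeometry.HodgeTheory.IsOfHodgeType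 B.dim B.X (2 * 3) 3 3 w ∧ w ∈ Literature.AlgebraicGeometry.HodgeTheory.weilClassesOf B ψ 3 d ∧ w' = Literature.AlgebraicGeometry.HodgeTheory.complexBetti.map g (2 * 3) w} := by
  intro A hA c hc hH
  by_cases hs : Literature.AlgebraicGeometry.Motives.AbelianVariety.IsSimple A
  · rcases hA with h | h
    · exact h6 A h hs c hc hH
    · exact Submodule.mem_sup_left (Submodule.mem_sup_left (Submodule.mem_sup_left (h7 A h hs c hc hH)))
  · exact hns A hA hs c hc hH

/-- **The skeleton theorem.** Concludes the crux BY NAME from the three registered stubs (no hypotheses;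
`sorry` lives only inside `stub_simple_prime_seven`, `stub_simple_six`, `stub_nonsimple`). [folklore] -/
theorem CodimThreeWeilGeneration_of : CodimThreeWeilGeneration :=
  CodimThreeWeilGeneration_of_stubs stub_simple_prime_seven stub_simple_six stub_nonsimple

end Summit.HodgeConjecture.HodgeConjecture.Cruxes.CodimThreeWeilGeneration.Birth
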